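/- Free-seat work of EXTRA WIDTH SEAT `ym-line-cbag-p1-w4` (prover-ym-line-cbag-p1-w4-g2-0), route `EguchiKawaiDirectionLadder`
(ideator ym-idea-2, LINE 8), crux `TripleSmallBallMargin` (stmt-QuantumFields-27724): S9 of the LEAD's v7 architecture, the
«h2-provider»: the Haar-pair measure of the block-local robust pair event of a block `c` is bounded by that of a rank-robust pair
event for a genuine Haar pair of the block size (to which (Ψ_rob) applies).  ROUTE-INDEPENDENT.  Nothing here bears on the
Yang–Mills mass gap. -/
import Summits.QuantumFields.YangMills.Theorems.EguchiKawaiDirectionLadderPolarDefectGeneral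
import HarnessLib

/-!
# Route `EguchiKawaiDirectionLadder`: the block fibre bound (S9, h2-provider)

* `compression_split_labels` — for ANY `X ∈ U(N)`, a labelling `ℓ`, a block `c` and a set `near` of labels:
  `X_{cc} = Θ + R + S` with `Θ` unitary, `rank R ≤ Σ_{a∈near} #{ℓ=a}` and `Σ|S|² ≤ 6·#far·Σ_{a far} (Σ|X_{ca}|²)² + ε` (`far = {a ≠ c, a ∉ near}`);
  the defect identity `1 − X_{cc}X_{cc}† = Σ_{a≠c} X_{ca}X_{ca}†` (`one_sub_compression_gram_eq_sum`) split into near (low rank) and far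
  (Frobenius-small) labels, then `exists_unitary_add_lowRank_add_small'`;
* `blockFibre_le_transfer` — with such decompositions of `X_{cc}` and `Y_{cc}`, the Haar-pair measure of the block-local robust pair event
  `{(D,D′) | ∃J′, rank J′ ≤ k, Σ|X_{cc}D·Y_{cc}D′ − Y_{cc}D′·X_{cc}D − J′|² ≤ s}` is at most the Haar-pair measure of
  `{(P,Q) | ∃L′, rank L′ ≤ k + 2(q₁+q₂), Σ|PQ − QP − L′|² ≤ 2s + 24(e₁+e₂+e₁e₂)}` (`haar_prod_robustPairEvent_transfer`) — the input slot
  for (Ψ_rob) at block size `#{ℓ = c}` in `haar_prod_le_prod_mul_of_blockPair_fibres` (`…BlockPairLaw`).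

HONEST FRAMING: linear algebra + one invariance statement; no small-ball estimate.  The route bears on the barrier-ledger fact
`EguchiKawaiBreakdown` only.
-/

set_option autoImplicit false

noncomputable section

open MeasureTheory
open scoped Matrix ENNReal
open Literature.Barriers.QuantumFields

namespace Summit.QuantumFields.YangMills.Theorems.EguchiKawaiDirectionLadder

variable {N m : ℕ}

/-- `Σ|(Σ_{a∈s} A_a)_{ij}|² ≤ #s · Σ_{a∈s} Σ|(A_a)_{ij}|²` (copy of the block-pair version for a general square index type). -/
theorem sum_norm_sq_finset_sum_le' {α : Type} [Fintype α] {ι : Type*} (s : Finset ι) (A : ι → Matrix α α ℂ) :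
    ∑ i, ∑ j, ‖(∑ a ∈ s, A a) i j‖ ^ 2 ≤ s.card * ∑ a ∈ s, ∑ i, ∑ j, ‖A a i j‖ ^ 2 := by
  have hentry : ∀ i j, ‖(∑ a ∈ s, A a) i j‖ ^ 2 ≤ s.card * ∑ a ∈ s, ‖A a i j‖ ^ 2 := by
    intro i j
    rw [Matrix.sum_apply]
    have h1 : ‖∑ a ∈ s, A a i j‖ ≤ ∑ a ∈ s, ‖A a i j‖ := norm_sum_le _ _
    calc ‖∑ a ∈ s, A a i j‖ ^ 2 ≤ (∑ a ∈ s, ‖A a i j‖) ^ 2 := pow_le_pow_left₀ (norm_nonneg _) h1 2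
      _ ≤ s.card * ∑ a ∈ s, ‖A a i j‖ ^ 2 := sq_sum_le_card_mul_sum_sq
  calc ∑ i, ∑ j, ‖(∑ a ∈ s, A a) i j‖ ^ 2 ≤ ∑ i, ∑ j, (s.card : ℝ) * ∑ a ∈ s, ‖A a i j‖ ^ 2 :=
        Finset.sum_le_sum fun i _ => Finset.sum_le_sum fun j _ => hentry i j
    _ = s.card * ∑ a ∈ s, ∑ i, ∑ j, ‖A a i j‖ ^ 2 := by
        rw [Finset.sum_comm (s := s)]
        simp only [← Finset.mul_sum]
        congr 1
        refine Finset.sum_congr rfl fun i _ => ?_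
        rw [Finset.sum_comm]

/-- **Compression split in the label language, for EVERY unitary** (no invertibility): `X_{cc} = Θ + R + S`, `Θ` unitary,
`rank R ≤ Σ_{a∈near}#{ℓ=a}`, `Σ|S|² ≤ 6·#far·Σ_{a far}(Σ|X_{ca}|²)² + ε`. -/
theorem compression_split_labels (ℓ : Fin N → Fin m) (X : UN N) (c : Fin m) (near : Finset (Fin m)) {ε : ℝ} (hε : 0 < ε) :
    ∃ Θ R S : Matrix {i : Fin N // ℓ i = c} {i : Fin N // ℓ i = c} ℂ,
      Θ ∈ Matrix.unitaryGroup {i : Fin N // ℓ i = c} ℂ ∧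
      R.rank ≤ ∑ a ∈ near, Fintype.card {i : Fin N // ℓ i = a} ∧
      ∑ i, ∑ j, ‖S i j‖ ^ 2 ≤
        6 * (((Finset.univ.erase c).filter (fun a => a ∉ near)).card *
          ∑ a ∈ (Finset.univ.erase c).filter (fun a => a ∉ near),
            (∑ i, ∑ j, ‖(X : Matrix (Fin N) (Fin N) ℂ).toBlock (fun i => ℓ i = c) (fun i => ℓ i = a) i j‖ ^ 2) ^ 2) + ε ∧
      (X : Matrix (Fin N) (Fin N) ℂ).toBlock (fun i => ℓ i = c) (fun i => ℓ i = c) = Θ + R + S := by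
  classical
  set O : Finset (Fin m) := Finset.univ.erase c with hO
  set G : Fin m → Matrix {i : Fin N // ℓ i = c} {i : Fin N // ℓ i = c} ℂ := fun a =>
    (X : Matrix (Fin N) (Fin N) ℂ).toBlock (fun i => ℓ i = c) (fun i => ℓ i = a) *
      ((X : Matrix (Fin N) (Fin N) ℂ).toBlock (fun i => ℓ i = c) (fun i => ℓ i = a))ᴴ with hG
  set D₁ := ∑ a ∈ O.filter (fun a => a ∈ near), G a with hD₁
  set D₂ := ∑ a ∈ O.filter (fun a => a ∉ near), G a with hD₂
  have hsplit : 1 - (X : Matrix (Fin N) (Fin N) ℂ).toBlock (fun i => ℓ i = c) (fun i => ℓ i = c) *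
      ((X : Matrix (Fin N) (Fin N) ℂ).toBlock (fun i => ℓ i = c) (fun i => ℓ i = c))ᴴ = D₁ + D₂ := by
    rw [one_sub_compression_gram_eq_sum X ℓ c, hD₁, hD₂]
    exact (Finset.sum_filter_add_sum_filter_not O (fun a => a ∈ near) G).symm
  obtain ⟨Θ, R, S, hΘ, hR, hS, hXeq⟩ := exists_unitary_add_lowRank_add_small' _ D₁ D₂ hsplit hε
  refine ⟨Θ, R, S, hΘ, hR.trans ?_, hS.trans ?_, hXeq⟩
  · -- rank of the near part
    calc D₁.rank ≤ ∑ a ∈ O.filter (fun a => a ∈ near), (G a).rank := rank_sum_le _ _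
      _ ≤ ∑ a ∈ O.filter (fun a => a ∈ near), Fintype.card {i : Fin N // ℓ i = a} :=
          Finset.sum_le_sum fun a _ => rank_mul_conjTranspose_le_card _
      _ ≤ ∑ a ∈ near, Fintype.card {i : Fin N // ℓ i = a} :=
          Finset.sum_le_sum_of_subset fun a ha => (Finset.mem_filter.1 ha).2
  · -- Frobenius mass of the far part
    have h1 : ∑ i, ∑ j, ‖D₂ i j‖ ^ 2 ≤ (O.filter (fun a => a ∉ near)).card *
        ∑ a ∈ O.filter (fun a => a ∉ near), ∑ i, ∑ j, ‖G a i j‖ ^ 2 := sum_norm_sq_finset_sum_le' _ _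
    have h2 : ∀ a, ∑ i, ∑ j, ‖G a i j‖ ^ 2 ≤
        (∑ i, ∑ j, ‖(X : Matrix (Fin N) (Fin N) ℂ).toBlock (fun i => ℓ i = c) (fun i => ℓ i = a) i j‖ ^ 2) ^ 2 :=
      fun a => sum_norm_sq_mul_conjTranspose_le_sq _
    have h3 : ∑ a ∈ O.filter (fun a => a ∉ near), ∑ i, ∑ j, ‖G a i j‖ ^ 2 ≤
        ∑ a ∈ O.filter (fun a => a ∉ near),
          (∑ i, ∑ j, ‖(X : Matrix (Fin N) (Fin N) ℂ).toBlock (fun i => ℓ i = c) (fun i => ℓ i = a) i j‖ ^ 2) ^ 2 :=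
      Finset.sum_le_sum fun a _ => h2 a
    have hcard : (0 : ℝ) ≤ (O.filter (fun a => a ∉ near)).card := Nat.cast_nonneg _
    nlinarith [mul_le_mul_of_nonneg_left h3 hcard]

/-- **The block fibre bound** (S9, h2): with decompositions `X_{cc} = Θ₁+R₁+S₁`, `Y_{cc} = Θ₂+R₂+S₂` (`Θ_μ` unitary, `rank R_μ ≤ q_μ`,
`Σ|S_μ|² ≤ e_μ`), the Haar-pair measure of the block-local robust pair event is bounded by that of the rank-robust pair event for a
Haar pair of the block size. -/
theorem blockFibre_le_transfer {α : Type} [Fintype α] [DecidableEq α] (Xc Yc : Matrix α α ℂ)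
    (Θ₁ Θ₂ : Matrix.unitaryGroup α ℂ) (R₁ S₁ R₂ S₂ : Matrix α α ℂ) {q₁ q₂ k : ℕ} {e₁ e₂ s : ℝ}
    (hX : Xc = (Θ₁ : Matrix α α ℂ) + R₁ + S₁) (hY : Yc = (Θ₂ : Matrix α α ℂ) + R₂ + S₂)
    (hR₁ : R₁.rank ≤ q₁) (hR₂ : R₂.rank ≤ q₂)
    (hS₁ : ∑ i, ∑ j, ‖S₁ i j‖ ^ 2 ≤ e₁) (hS₂ : ∑ i, ∑ j, ‖S₂ i j‖ ^ 2 ≤ e₂) :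
    (Literature.MathematicalPhysics.QuantumFieldTheory.haarProbability (Matrix.unitaryGroup α ℂ)).prod
        (Literature.MathematicalPhysics.QuantumFieldTheory.haarProbability (Matrix.unitaryGroup α ℂ))
      {V : Matrix.unitaryGroup α ℂ × Matrix.unitaryGroup α ℂ | ∃ J : Matrix α α ℂ, J.rank ≤ k ∧
        ∑ i, ∑ j, ‖(Xc * (V.1 : Matrix α α ℂ) * (Yc * (V.2 : Matrix α α ℂ)) -
          Yc * (V.2 : Matrix α α ℂ) * (Xc * (V.1 : Matrix α α ℂ)) - J) i j‖ ^ 2 ≤ s} ≤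
    (Literature.MathematicalPhysics.QuantumFieldTheory.haarProbability (Matrix.unitaryGroup α ℂ)).prod
        (Literature.MathematicalPhysics.QuantumFieldTheory.haarProbability (Matrix.unitaryGroup α ℂ))
      {P : Matrix.unitaryGroup α ℂ × Matrix.unitaryGroup α ℂ | ∃ L : Matrix α α ℂ, L.rank ≤ k + 2 * (q₁ + q₂) ∧
        ∑ i, ∑ j, ‖((P.1 : Matrix α α ℂ) * (P.2 : Matrix α α ℂ) - (P.2 : Matrix α α ℂ) * (P.1 : Matrix α α ℂ) - L) i j‖ ^ 2 ≤
          2 * s + 24 * (e₁ + e₂ + e₁ * e₂)} := by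
  subst hX hY
  exact haar_prod_robustPairEvent_transfer Θ₁ Θ₂ R₁ S₁ R₂ S₂ hR₁ hR₂ hS₁ hS₂

end Summit.QuantumFields.YangMills.Theorems.EguchiKawaiDirectionLadder

end
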